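import Mathlib
import Summits.ValiantsHypothesis.ValiantsHypothesis.Theses.ValuativeGCT
import Summits.ValiantsHypothesis.ValiantsHypothesis.Theorems.ValuativeGCTValuativeFlipSmallBodyWeightVectors
import Summits.ValiantsHypothesis.ValiantsHypothesis.Theorems.ValuativeGCTValuativeBound
import Literature.Computability.AlgebraicComplexity.MultiplicityObstructionsProofs
import Literature.NumberTheory.DiophantineGeometry.SchurWeylPlethysmOrbitWeightsProofs
import Literature.NumberTheory.DiophantineGeometry.SchurWeylPlethysmKroneckerBoundProofs
import Literature.Computability.Complexity.OccurrenceObstructionsBIP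
import Summits.ValiantsHypothesis.ValiantsHypothesis.Theorems.ValuativeGCTNoValuativeFlipOutsideKL

/-!
# No equations of `Det_m` of small body: `K_m(λ*) = a_λ(δ[m])` for `|λ̄| ≤ m`, and no small-body
# valuative flip

Wall-breaker axis D (det-orbit-closure multiplicity bounds) for crux `ValuativeGCT.ValuativeFlip`
(stmt-ValiantsHypothesis-12624); the first lemma of the `TailFlip` crux idea card
`Cruxes/TailFlip/Ideas/mixed-discriminant-dictionary.md` (`NoSmallBodyEquations`, `NoSmallBodyFlip`,
there only `def … : Prop`), proved here UNCONDITIONALLY and without Procesi's theorem on trace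
identities: the determinant side is tested on the diagonal pencil `∏_a (x_{i₀} + ⟨t_a, x⟩)`, whose
coefficients are the elementary multisymmetric polynomials, free up to weighted degree `m`
(`…SmallBodyWeightVectors`, `Literature/RingTheory/Multisymmetric/LowDegreeFreeness.lean`).

* `orbitMultiplicity_detFormLex_eq_plethysmCoeff_of_body_le` — weight form, any field of
  characteristic zero: if `|χ| = -mD` and the body `mD + χ i₀ ≤ m` at some letter `i₀`, the
  multiplicity of `χ` in `k[Δ(det_m)]` equals its multiplicity in `k[Sym^m k^{m×m}]` (no highest-weight
  vector of weight `χ` vanishes on `GL · det_m`; rank–nullity for the quotient map on the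
  highest-weight space, complete reducibility `map_highestWeightSpace_eq_of_surjective`).
* `noSmallBodyEquations` — partition form over `ℂ`: for `λ ⊢ mδ` with at most `m²` parts and
  `bodySize λ = mδ - λ₁ ≤ m`, `K_m(λ*) = orbitMultiplicity ℂ det_m m λ* = plethysmCoeff ℂ (MatIdx m) m λ*`
  (`λ* = partitionWeightLex m λ`; the base letter is the top letter, where `λ*` takes the value `-λ₁`).
* `noSmallBodyFlip` — crux currency: at body `≤ m` NO admissible centre `(U, r)` flips at ANY inner
  size `n ≤ m`: `mult_{λ*} ℂ[Δ_m(X₀₀^{m-n} per_n)] ≤ a_λ(δ[m]) = K_m(λ*) ≤ dim T_U(λ)` (plethysm bound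
  `orbitMultiplicity_le_plethysmCoeff_holds`, this file, and the PROVED route crux `ValuativeBound`).
  With Kadish–Landsberg (`λ₁ ≥ δ(m-n)`) every witness of `ValuativeFlip` / `TailFlip` therefore has
  `m < |λ̄| ≤ nδ`, i.e. degree `δ > m/n` at every window position — a constraint on all tail lines,
  complementing the landed `StableRay` (which only bounds Kronecker-type flips on the same shapes).

No new definitions; axioms standard. [BLMW 2011 §4.4–§5.2 (multiplicities, plethysm bound);
Bürgisser–Ikenmeyer–Panova 2019 §2 (body of a partition); the theorem itself is new]
-/

set_option linter.dupNamespace false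

namespace Summit.ValiantsHypothesis.ValiantsHypothesis.Theorems.ValuativeFlip

open MvPolynomial
open scoped BigOperators Matrix
open Literature.NumberTheory.DiophantineGeometry
open Literature.Computability.AlgebraicComplexity
open Literature.Computability.Complexity

noncomputable section

/-- **No equations of `Det_m` at a weight of small body** (weight form, characteristic zero).  If
`|χ| = -mD` and `mD + χ i₀ ≤ m` for some letter `i₀`, then the multiplicity of the highest weight `χ`
in the coordinate ring `k[Δ(det_m)]` of the determinant orbit closure equals its multiplicity in the
polynomial ring `k[Sym^m k^{m×m}]` (`plethysmCoeff`): the quotient map is injective on the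
highest-weight space of weight `χ` (`not_mem_orbitVanishingIdeal_detFormLex_of_body_le`) and
surjective onto that of the quotient (complete reducibility). [new; method BLMW 2011 §5.2] -/
theorem orbitMultiplicity_detFormLex_eq_plethysmCoeff_of_body_le {k : Type*} [Field k] [CharZero k]
    {m : ℕ} (i₀ : MatIdx m) (χ : Weight (MatIdx m)) (D : ℕ) (hD : χ.size = -((m * D : ℕ) : ℤ))
    (hbody : ((m * D : ℕ) : ℤ) + χ i₀ ≤ m) :
    orbitMultiplicity k (detFormLex k m) m χ = plethysmCoeff k (MatIdx m) m χ := by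
  classical
  have hm : m ≠ 0 := (Fin.pos (ofLex i₀).1).ne'
  set V : Submodule k (MvPolynomial (DegIdx (MatIdx m) m) k) := highestWeightSpace (coordRep (MatIdx m) k m) χ
    with hV
  haveI : FiniteDimensional k V := finiteDimensional_highestWeightSpace_coordRep_holds hm χ
  let π : (coordRep (MatIdx m) k m).IntertwiningMap (orbitCoordRep (detFormLex k m) m) :=
    ⟨(Ideal.Quotient.mkₐ k (orbitVanishingIdeal (detFormLex k m) m)).toLinearMap,
      fun _ => LinearMap.ext fun _ => rfl⟩
  have hmap := map_highestWeightSpace_eq_of_surjective π (Ideal.Quotient.mkₐ_surjective k _)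
    (isSemisimpleRepresentation_coordRep m) χ
  have hr := LinearMap.finrank_range_add_finrank_ker (π.toLinearMap ∘ₗ V.subtype)
  rw [LinearMap.range_comp, Submodule.range_subtype] at hr
  have hker : LinearMap.ker (π.toLinearMap ∘ₗ V.subtype) = ⊥ := by
    rw [LinearMap.ker_eq_bot']
    intro F hF
    rw [LinearMap.comp_apply] at hF
    have hFI : (F : MvPolynomial (DegIdx (MatIdx m) m) k) ∈ orbitVanishingIdeal (detFormLex k m) m :=
      Ideal.Quotient.eq_zero_iff_mem.mp hF
    by_contra hne
    have hF0 : (F : MvPolynomial (DegIdx (MatIdx m) m) k) ≠ 0 := fun h =>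
      hne (Subtype.ext (by rw [h]; rfl))
    exact not_mem_orbitVanishingIdeal_detFormLex_of_body_le i₀
      (highestWeightSpace_le_weightSpace _ _ F.2) hD hbody hF0 hFI
  rw [hker, finrank_bot, add_zero] at hr
  unfold orbitMultiplicity plethysmCoeff hwMultiplicity
  rw [← hmap]
  exact hr

/-- The transported partition weight takes the value `-λ₁` at the top letter. [folklore] -/
theorem partitionWeightLex_apply_top {m : ℕ} (hmm : 0 < m * m) {N : ℕ} (lam : Nat.Partition N) :
    partitionWeightLex m lam (matIdxEquiv m ⟨m * m - 1, Nat.sub_one_lt_of_lt hmm⟩) =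
      -((lam.parts.sup : ℕ) : ℤ) := by
  change (Weight.dualOfPartition (m * m) lam) ((matIdxEquiv m).symm
    (matIdxEquiv m ⟨m * m - 1, Nat.sub_one_lt_of_lt hmm⟩)) = _
  rw [OrderIso.symm_apply_apply, Weight.dualOfPartition_apply_last lam hmm,
    sup_parts_eq_getD_sortedParts]

/-- **No equations of `Det_m` of small body** (`NoSmallBodyEquations` of the `TailFlip` card
mixed-discriminant-dictionary, now a theorem).  For `λ ⊢ mδ` with at most `m²` parts and body
`|λ̄| = mδ - λ₁ ≤ m`, the determinant orbit closure has NO equation of type `λ`: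
`K_m(λ*) = mult_{λ*} ℂ[Δ(det_m)] = a_λ(δ[m])` (the full plethysm coefficient).  Registered
sub-goal of the crux (wall-breaker k7, axis D). [new] -/
theorem noSmallBodyEquations (m δ : ℕ) [NeZero m] (lam : Nat.Partition (m * δ)) (hlam : lam.parts.card ≤ m * m) (hbody : bodySize lam ≤ m) : orbitMultiplicity ℂ (detFormLex ℂ m) m (partitionWeightLex m lam) = plethysmCoeff ℂ (MatIdx m) m (partitionWeightLex m lam) := by
  have hm : 0 < m := Nat.pos_of_ne_zero (NeZero.ne m)
  have hmm : 0 < m * m := Nat.mul_pos hm hm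
  refine orbitMultiplicity_detFormLex_eq_plethysmCoeff_of_body_le
    (matIdxEquiv m ⟨m * m - 1, Nat.sub_one_lt_of_lt hmm⟩) _ δ
    (size_toMatIdx_dualOfPartition m lam hlam) ?_
  rw [partitionWeightLex_apply_top hmm]
  unfold bodySize at hbody
  have hsup := sup_parts_le lam
  omega

/-- **No small-body flip, in the crux's own currency** (`NoSmallBodyFlip` of the `TailFlip` card, now
a theorem).  At body `bodySize λ ≤ m`, for EVERY inner size `n ≤ m` and EVERY admissible centre
`(U, r)`, the padded-permanent multiplicity does not exceed the valuative truncation: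
`mult_{λ*} ℂ[Δ_m(X₀₀^{m-n} per_n)] ≤ a_λ(δ[m]) = K_m(λ*) ≤ dim T_U(λ)` (plethysm bound,
`noSmallBodyEquations`, and the proved route crux `ValuativeBound`).  Hence every witness of
`ValuativeFlip` has body `> m`, so (Kadish–Landsberg) degree `δ > m/n`.  Registered sub-goal of the
crux (wall-breaker k7, axis D). [new] -/
theorem noSmallBodyFlip : ∀ (n m : ℕ) [NeZero m], n ≤ m → ∀ (U : Submodule ℂ (MatIdx m → ℂ)) (r δ : ℕ) (lam : Nat.Partition (m * δ)), (∀ u ∈ U, (Matrix.of fun a b : Fin m => u (toLex (a, b))).rank ≤ r) → lam.parts.card ≤ m * m → bodySize lam ≤ m → let χ : Weight (MatIdx m) := (Weight.dualOfPartition (m * m) lam).toMatIdx; let T : Submodule ℂ (MvPolynomial (MatIdx m × MatIdx m) ℂ) := MvPolynomial.homogeneousSubmodule (MatIdx m × MatIdx m) ℂ (m * δ) ⊓ ((MvPolynomial.vanishingIdeal ℂ {p : MatIdx m × MatIdx m → ℂ | ∀ j : MatIdx m, (fun i => p (j, i)) ∈ U}) ^ (δ * (m - r))).restrictScalars ℂ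 ⊓ (⨅ (M : Matrix (MatIdx m) (MatIdx m) ℂ) (_ : linSubst (MatIdx m) ℂ M (detFormLex ℂ m) = detFormLex ℂ m), LinearMap.ker ((MvPolynomial.aeval (R := ℂ) fun p : MatIdx m × MatIdx m => ∑ l : MatIdx m, M l p.2 • MvPolynomial.X (p.1, l)).toLinearMap - LinearMap.id (R := ℂ) (M := MvPolynomial (MatIdx m × MatIdx m) ℂ))) ⊓ (⨅ (g : Matrix.GeneralLinearGroup (MatIdx m) ℂ) (_ : IsUpperTriangular g), LinearMap.ker ((MvPolynomial.aeval (R := ℂ) fun p : MatIdx m × MatIdx m => ∑ l : MatIdx m, ((g⁻¹ : Matrix.GeneralLinearGroup (MatIdx m) ℂ) : Matrix (MatIdx m) (MatIdx m) ℂ) p.1 l • MvPolynomial.X (l, p.2)).toLinearMap - weightChar χ g • LinearMap.id (R := ℂ) (M := MvPolynomial (MatIdx m × MatIdx m) ℂ))); orbitMultiplicity ℂ (paddedPerFormLex ℂ n m) m χ ≤ Module.finrank ℂ ↥T := by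
  intro n m _ hnm U r δ lam hU hlam hbody χ T
  have h1 : orbitMultiplicity ℂ (paddedPerFormLex ℂ n m) m χ ≤ plethysmCoeff ℂ (MatIdx m) m χ :=
    orbitMultiplicity_le_plethysmCoeff_holds _ (NeZero.ne m) (paddedPerFormLex_isHomogeneous ℂ hnm) χ
  have h2 : plethysmCoeff ℂ (MatIdx m) m χ = orbitMultiplicity ℂ (detFormLex ℂ m) m χ :=
    (noSmallBodyEquations m δ lam hlam hbody).symm
  have h3 : orbitMultiplicity ℂ (detFormLex ℂ m) m χ ≤ Module.finrank ℂ ↥T :=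
    Summit.ValiantsHypothesis.ValiantsHypothesis.Theorems.ValuativeBound.ValuativeBound_proof
      m U r hU δ lam hlam
  rw [h2] at h1
  exact h1.trans h3

/-- **Where a valuative flip can live: body `> m` and degree `δ > m/n`.**  If at `(n, m)`, `n ≤ m`,
some admissible centre `(U, r)` flips at `λ ⊢ mδ` (`≤ m²` parts) — `dim T_U(λ) < mult_{λ*} ℂ[Δ_m(pp)]`,
the body of the route decl `ValuativeFlip` verbatim — then `m < bodySize λ` (`noSmallBodyFlip`) and
`m < n·δ` (Kadish–Landsberg `δ(m-n) ≤ λ₁`, landed `kadishLandsberg_of_hasHighestWeight_paddedPerOrbitRep`,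
so `bodySize λ ≤ nδ`).  In the tail `m/n → ∞`, so witnesses have unbounded degree. [new] -/
theorem body_gt_and_degree_gt_of_flip {n m : ℕ} [NeZero m] (hnm : n ≤ m) (U : Submodule ℂ (MatIdx m → ℂ)) (r δ : ℕ) (lam : Nat.Partition (m * δ)) (hU : ∀ u ∈ U, (Matrix.of fun a b : Fin m => u (toLex (a, b))).rank ≤ r) (hlam : lam.parts.card ≤ m * m) (hflip : (let χ : Weight (MatIdx m) := (Weight.dualOfPartition (m * m) lam).toMatIdx; let T : Submodule ℂ (MvPolynomial (MatIdx m × MatIdx m) ℂ) := MvPolynomial.homogeneousSubmodule (MatIdx m × MatIdx m) ℂ (m * δ) ⊓ ((MvPolynomial.vanishingIdeal ℂ {p : MatIdx m × MatIdx m → ℂ | ∀ j : MatIdx m, (fun i => p (j, i)) ∈ U}) ^ (δ * (m - r))).restrictScalars ℂ ⊓ (⨅ (M : Matrix (MatIdx m) (MatIdx m) ℂ) (_ : linSubst (MatIdx m) ℂ M (detFormLex ℂ m) = detFormLex ℂ m), LinearMap.ker ((MvPolynomial.aeval (R := ℂ) fun p : MatIdx m × MatIdx m => ∑ l : MatIdx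 m, M l p.2 • MvPolynomial.X (p.1, l)).toLinearMap - LinearMap.id (R := ℂ) (M := MvPolynomial (MatIdx m × MatIdx m) ℂ))) ⊓ (⨅ (g : Matrix.GeneralLinearGroup (MatIdx m) ℂ) (_ : IsUpperTriangular g), LinearMap.ker ((MvPolynomial.aeval (R := ℂ) fun p : MatIdx m × MatIdx m => ∑ l : MatIdx m, ((g⁻¹ : Matrix.GeneralLinearGroup (MatIdx m) ℂ) : Matrix (MatIdx m) (MatIdx m) ℂ) p.1 l • MvPolynomial.X (l, p.2)).toLinearMap - weightChar χ g • LinearMap.id (R := ℂ) (M := MvPolynomial (MatIdx m × MatIdx m) ℂ))); Module.finrank ℂ ↥T < orbitMultiplicity ℂ (paddedPerFormLex ℂ n m) m χ)) : m < bodySize lam ∧ m < n * δ := by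
  have hbody : m < bodySize lam := by
    by_contra hle
    rw [not_lt] at hle
    have h := noSmallBodyFlip n m hnm U r δ lam hU hlam hle
    exact absurd hflip (not_lt.mpr h)
  refine ⟨hbody, ?_⟩
  -- the flip makes `λ*` occur in `ℂ[Δ_m(pp)]`; Kadish–Landsberg bounds the body by `nδ`
  have hocc : HasHighestWeight (paddedPerOrbitRep ℂ n m) (Weight.dualOfPartition (m * m) lam).toMatIdx := by
    intro hbot
    have h0 : orbitMultiplicity ℂ (paddedPerFormLex ℂ n m) m
        (Weight.dualOfPartition (m * m) lam).toMatIdx = 0 := by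
      rw [orbitMultiplicity, hwMultiplicity]
      change Module.finrank ℂ ↥(highestWeightSpace (paddedPerOrbitRep ℂ n m) _) = 0
      rw [hbot]
      exact finrank_bot ℂ _
    have h1 := hflip
    simp only [h0] at h1
    exact Nat.not_lt_zero _ h1
  obtain ⟨hKL, -⟩ :=
    NoValuativeFlip.kadishLandsberg_of_hasHighestWeight_paddedPerOrbitRep hnm lam hlam hocc
  unfold bodySize at hbody
  have hsup := sup_parts_le lam
  have hmul : δ * (m - n) = δ * m - δ * n := Nat.mul_sub δ m n
  have hcomm : δ * m = m * δ := Nat.mul_comm δ m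
  have hcomm' : n * δ = δ * n := Nat.mul_comm n δ
  omega

end

end Summit.ValiantsHypothesis.ValiantsHypothesis.Theorems.ValuativeFlip
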